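import Summits.CriticalPhenomena.PercolationContinuityZ3.Theorems.Transplant.SkelPhiNegReachRoomsC
import HarnessLib

/-!
# N1 (the `{±1}` node), (C) column file (C-S10): FROM FIVE PRIMITIVE FLOORS TO EVERY BUDGET of the one-frame corridor at the record values
# `Skelφ.CorrRec.*`: (P1) `2000·(T + 2) ≤ n`, (P2) `2000·(T + 2)·U ≤ nℓ − n`, (P3) `W_A ≤ 24·n`, (P4) `U·(L0_A + 1) ≤ 12·Δ`, (P5) `r_i ≤ 4·b₀_i`
# (RULING B.16), with `|v| ≤ n`, `nℓ − n < Δ ≤ nℓ` (`Δ = modulus n h v v_β`, `U = n + |h|`): §1 unit facts (`4000·U ≤ Δ`, `U·W_B ≤ Δ + 2U`,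
# `U·La ≤ 3Δ + 4U`, `Δ − 3U ≤ U·sA`, **`N_A ≤ 24`**, **`N_B ≤ 100`**, `U·q_y ≤ Δ + 2U + 101·T·U`); §2 `floors_rounds` (small-box floors, joins, step
# budget); §3 `floors_band` (`hbx1–3`, `hby1–3`); §4 `floors_target` (`hxL1`, `hxL3`, `hyL1–3`).
builds on p205010 (kernel theorem, internal audit signed; external expert review pending) — nothing in this file uses p205010; nothing here is a
claim about the open node `SamePDropOfSkeletonNeg`. Lane `prim-bschramm`, seat `prim-bschramm-p5` (gen 9; (C) lineage); helper file
(`--supports stmt-CriticalPhenomena-4575`). [cite: KozmaNitzan2024, §4 Lemma 12 (pp. 23–25)] [cite: MartineauTassion2017, §4.3 Lemma 4.2]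
-/

noncomputable section

namespace Summit.CriticalPhenomena.PercolationContinuityZ3.Theorems

namespace Transplant

namespace Skelφ

namespace CorrRec

open Literature.Probability.Percolation Literature.Probability.LatticeModels
open Literature.Probability.Percolation.KozmaNitzan.Cells (oth oth_ne sgOf sgOf_sign eq_oth_of_ne)
open TwoAxis.Para (modulus)
open ChainPlanar ChainPara

section Units

variable {n ℓ T : ℕ} {h v vβ aW bL : ℤ}
  (hn : 1 ≤ n) (hvn : |v| ≤ n) (hΔlo : (n : ℤ) * ℓ - n < modulus n h v vβ) (hΔhi : modulus n h v vβ ≤ (n : ℤ) * ℓ)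
  (P1 : 2000 * (T + 2) ≤ n) (P2 : 2000 * ((T : ℤ) + 2) * (shearUnit n h : ℤ) ≤ (n : ℤ) * ℓ - n)

/-! ## §1 Unit facts -/

/-- `n ≤ U = n + |h|`. [folklore] -/
theorem n_le_U (n : ℕ) (h : ℤ) : (n : ℤ) ≤ (shearUnit n h : ℤ) := by unfold shearUnit; push_cast; linarith [abs_nonneg h, Int.natCast_natAbs h]

include hΔlo P2 in
/-- `2000·(T+2)·U ≤ Δ`, hence `4000·U ≤ Δ` and `2000·T·U ≤ Δ`. [folklore] -/
theorem U_floor : 2000 * ((T : ℤ) + 2) * (shearUnit n h : ℤ) ≤ modulus n h v vβ ∧ 4000 * (shearUnit n h : ℤ) ≤ modulus n h v vβ ∧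
    2000 * (T : ℤ) * (shearUnit n h : ℤ) ≤ modulus n h v vβ := by
  have hU : (0 : ℤ) ≤ (shearUnit n h : ℤ) := by positivity
  have hT : (0 : ℤ) ≤ (T : ℤ) := by positivity
  have h1 : 2000 * ((T : ℤ) + 2) * (shearUnit n h : ℤ) ≤ modulus n h v vβ := by linarith
  refine ⟨h1, ?_, ?_⟩ <;> nlinarith

include hn hΔlo in
/-- `U·W_B ≤ Δ + 2U` and `Δ < U·W_B`. [folklore] -/
theorem UQ_le (hΔhi : modulus n h v vβ ≤ (n : ℤ) * ℓ) :
    (shearUnit n h : ℤ) * (Qw n ℓ h : ℕ) ≤ modulus n h v vβ + 2 * (shearUnit n h : ℤ) ∧ modulus n h v vβ < (shearUnit n h : ℤ) * (Qw n ℓ h : ℕ) := by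
  obtain ⟨u1, u2⟩ := UQw_bounds hn ℓ h
  have := n_le_U n h
  constructor <;> linarith

include hΔlo in
/-- `U·La ≤ 3Δ + 4U` (`La = ⌊3nℓ/U⌋ + 1`). [folklore] -/
theorem ULa_le : (shearUnit n h : ℤ) * ((3 * (n * ℓ) / shearUnit n h + 1 : ℕ) : ℤ) ≤ 3 * modulus n h v vβ + 4 * (shearUnit n h : ℤ) := by
  have h1 : shearUnit n h * (3 * (n * ℓ) / shearUnit n h) ≤ 3 * (n * ℓ) := Nat.mul_div_le _ _
  have h2 : ((shearUnit n h * (3 * (n * ℓ) / shearUnit n h + 1) : ℕ) : ℤ) ≤ 3 * ((n : ℤ) * ℓ) + shearUnit n h := by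
    have : shearUnit n h * (3 * (n * ℓ) / shearUnit n h + 1) ≤ 3 * (n * ℓ) + shearUnit n h := by rw [Nat.mul_add, Nat.mul_one]; omega
    exact_mod_cast this
  push_cast at h2 ⊢
  have := n_le_U n h
  linarith

include hn hΔhi in
/-- `Δ − 3U ≤ U·sA`. [folklore] -/
theorem UsA_ge : modulus n h v vβ - 3 * (shearUnit n h : ℤ) ≤ (shearUnit n h : ℤ) * sA n ℓ h := by
  obtain ⟨s1, -⟩ := sA_bounds hn ℓ h
  obtain ⟨u1, -⟩ := UQw_bounds hn ℓ h
  have hU : (0 : ℤ) ≤ (shearUnit n h : ℤ) := by positivity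
  have := mul_le_mul_of_nonneg_left s1 hU
  nlinarith

include hn hΔlo hΔhi P2 in
/-- **`T + 1 ≤ sA`** (the v-rounds contract). [folklore] -/
theorem hsT_of_floors : (T : ℤ) + 1 ≤ sA n ℓ h := by
  have h1 := UsA_ge (v := v) (vβ := vβ) (ℓ := ℓ) hn hΔhi
  obtain ⟨f1, f2, f3⟩ := U_floor (v := v) (vβ := vβ) hΔlo P2
  have hn1 : (1 : ℤ) ≤ n := by exact_mod_cast hn
  have hU1 : (1 : ℤ) ≤ (shearUnit n h : ℤ) := by have := n_le_U n h; linarith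
  by_contra hc
  have hc := not_le.1 hc
  have h2 : (shearUnit n h : ℤ) * sA n ℓ h < (shearUnit n h : ℤ) * ((T : ℤ) + 1) := by
    exact mul_lt_mul_of_pos_left hc (by linarith)
  nlinarith

include hn hΔlo hΔhi P2 in
/-- **`N_A ≤ 24`** under (P2) and (P4). [folklore] -/
theorem NA_le (P4 : (shearUnit n h : ℤ) * (((L0A bL : ℕ) : ℤ) + 1) ≤ 12 * modulus n h v vβ) : NA n ℓ h T bL ≤ 24 := by
  have hsT := hsT_of_floors (v := v) (vβ := vβ) hn hΔlo hΔhi P2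
  have h1 := UsA_ge (v := v) (vβ := vβ) (ℓ := ℓ) hn hΔhi
  obtain ⟨f1, f2, f3⟩ := U_floor (v := v) (vβ := vβ) hΔlo P2
  have hn1 : (1 : ℤ) ≤ n := by exact_mod_cast hn
  have hU0 : (0 : ℤ) < (shearUnit n h : ℤ) := by have := n_le_U n h; linarith
  set d := (sA n ℓ h - T).toNat with hd
  have hd1 : (d : ℤ) = sA n ℓ h - T := Int.toNat_of_nonneg (by linarith)
  have hdpos : 0 < d := by omega
  have key : ((L0A bL : ℕ) : ℤ) < 25 * (d : ℤ) := by
    by_contra hc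
    have hc := not_lt.1 hc
    have e1 : (shearUnit n h : ℤ) * (25 * (d : ℤ)) ≤ (shearUnit n h : ℤ) * ((L0A bL : ℕ) : ℤ) := mul_le_mul_of_nonneg_left hc hU0.le
    have e2 : (shearUnit n h : ℤ) * (d : ℤ) ≥ modulus n h v vβ - 3 * (shearUnit n h : ℤ) - (T : ℤ) * (shearUnit n h : ℤ) := by
      rw [hd1]; nlinarith
    nlinarith
  have key' : L0A bL < 25 * d := by exact_mod_cast key
  unfold NA
  rw [← hd]
  have := (Nat.div_lt_iff_lt_mul hdpos).2 key'
  omega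

include hn hvn hΔlo hΔhi P1 P2 in
/-- **`L0_B ≤ 49n + 25T`** and **`N_B ≤ 100`** under (P1)–(P4). [folklore] -/
theorem NB_le (P3 : ((WA n aW : ℕ) : ℤ) ≤ 24 * n) (P4 : (shearUnit n h : ℤ) * (((L0A bL : ℕ) : ℤ) + 1) ≤ 12 * modulus n h v vβ) :
    ((L0B n ℓ h v T aW bL : ℕ) : ℤ) ≤ 49 * n + 25 * T ∧ NB n ℓ h v T aW bL ≤ 100 := by
  have hNA := NA_le (v := v) (vβ := vβ) (T := T) (bL := bL) hn hΔlo hΔhi P2 P4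
  have hNA' : ((NA n ℓ h T bL : ℕ) : ℤ) ≤ 24 := by exact_mod_cast hNA
  have hT0 : (0 : ℤ) ≤ T := by positivity
  have hv0 : (0 : ℤ) ≤ |v| := abs_nonneg v
  have hL : ((L0B n ℓ h v T aW bL : ℕ) : ℤ) ≤ 49 * n + 25 * T := by
    unfold L0B; push_cast
    have : (((NA n ℓ h T bL : ℕ) : ℤ) + 1) * ((T : ℤ) + |v|) ≤ 25 * ((T : ℤ) + |v|) := mul_le_mul_of_nonneg_right (by linarith) (by positivity)
    linarith
  refine ⟨hL, ?_⟩
  have hTn : 2000 * T ≤ n := by nlinarith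
  have hL' : L0B n ℓ h v T aW bL < 101 * (n - T) := by
    have : ((L0B n ℓ h v T aW bL : ℕ) : ℤ) < 101 * ((n : ℤ) - T) := by
      have : (T : ℤ) * 2000 ≤ n := by exact_mod_cast (by linarith : T * 2000 ≤ n)
      linarith
    have hTn' : T ≤ n := by omega
    zify [hTn']; exact this
  unfold NB
  have hd : 0 < n - T := by omega
  have := (Nat.div_lt_iff_lt_mul hd).2 hL'
  omega

include hn hvn hΔlo hΔhi P1 P2 in
/-- **`U·q_y ≤ Δ + 2U + 101·T·U`**. [folklore] -/
theorem Uqy_le (P3 : ((WA n aW : ℕ) : ℤ) ≤ 24 * n) (P4 : (shearUnit n h : ℤ) * (((L0A bL : ℕ) : ℤ) + 1) ≤ 12 * modulus n h v vβ) :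
    (shearUnit n h : ℤ) * ((qy n ℓ h v T aW bL : ℕ) : ℤ) ≤ modulus n h v vβ + 2 * (shearUnit n h : ℤ) + 101 * (T : ℤ) * (shearUnit n h : ℤ) := by
  obtain ⟨-, hNB⟩ := NB_le (vβ := vβ) hn hvn hΔlo hΔhi P1 P2 P3 P4
  obtain ⟨uq, -⟩ := UQ_le (v := v) (vβ := vβ) (ℓ := ℓ) hn hΔlo hΔhi
  have hNB' : ((NB n ℓ h v T aW bL : ℕ) : ℤ) ≤ 100 := by exact_mod_cast hNB
  have hU : (0 : ℤ) ≤ (shearUnit n h : ℤ) := by positivity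
  have hT0 : (0 : ℤ) ≤ T := by positivity
  unfold qy; push_cast
  have : (shearUnit n h : ℤ) * ((((NB n ℓ h v T aW bL : ℕ) : ℤ) + 1) * T) ≤ (shearUnit n h : ℤ) * (101 * T) :=
    mul_le_mul_of_nonneg_left (by nlinarith) hU
  nlinarith

/-- `Wmy + Wpy = 2n + |v|`. [folklore] -/
theorem Wmy_add_Wpy (n : ℕ) (v : ℤ) : ((Wmy n v : ℕ) : ℤ) + (Wpy n v : ℕ) = 2 * n + |v| := by
  unfold Wmy Wpy; push_cast
  have := Int.toNat_add_toNat_neg_eq_natAbs v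
  have e : ((v.toNat : ℕ) : ℤ) + (((-v).toNat : ℕ) : ℤ) = |v| := by rw [← Int.natCast_natAbs, ← this]; push_cast; ring
  linarith

/-! ## §2 The floors of the rounds -/

include hn hvn hΔlo hΔhi P1 P2 in
/-- **The small-box floors of both localisation segments, the join floors and the step budget** from (P1)–(P4).
[cite: KozmaNitzan2024, §4 Lemma 12 (pp. 23–25)] -/
theorem floors_rounds (P3 : ((WA n aW : ℕ) : ℤ) ≤ 24 * n) (P4 : (shearUnit n h : ℤ) * (((L0A bL : ℕ) : ℤ) + 1) ≤ 12 * modulus n h v vβ) :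
    ((shearUnit n h : ℤ) * (((L0A bL : ℕ) : ℤ) + (Qw n ℓ h : ℕ) + T + (3 * (n * ℓ) / shearUnit n h + 1 : ℕ) + 1) ≤ 77 * modulus n h v vβ) ∧
    (modulus n h v vβ * (((L0B n ℓ h v T aW bL : ℕ) : ℤ) + T + n) +
      |v| * ((shearUnit n h : ℤ) * (((L0A bL : ℕ) : ℤ) + (Qw n ℓ h : ℕ) + T + (3 * (n * ℓ) / shearUnit n h + 1 : ℕ) + 1)) ≤ 76 * modulus n h v vβ * n) ∧
    ((shearUnit n h : ℤ) * (((qy n ℓ h v T aW bL : ℕ) : ℤ) + (3 * (n * ℓ) / shearUnit n h + 1 : ℕ) + 1) ≤ 77 * modulus n h v vβ) ∧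
    (modulus n h v vβ * (((L0B n ℓ h v T aW bL : ℕ) : ℤ) + T + n) +
      |v| * ((shearUnit n h : ℤ) * (((qy n ℓ h v T aW bL : ℕ) : ℤ) + (3 * (n * ℓ) / shearUnit n h + 1 : ℕ) + 1)) ≤ 76 * modulus n h v vβ * n) ∧
    ((T : ℤ) + 1 ≤ sA n ℓ h) ∧ (T + 1 ≤ n) ∧ (NA n ℓ h T bL + NB n ℓ h v T aW bL ≤ 1199) ∧
    (((T : ℤ) + 2) * ((n + h.natAbs : ℕ) : ℤ) ≤ (n : ℤ) * ℓ + 1) ∧ (T ≤ n) := by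
  obtain ⟨f1, f2, f3⟩ := U_floor (v := v) (vβ := vβ) hΔlo P2
  obtain ⟨uq, lq⟩ := UQ_le (v := v) (vβ := vβ) (ℓ := ℓ) hn hΔlo hΔhi
  have ula := ULa_le (v := v) (vβ := vβ) (ℓ := ℓ) (n := n) (h := h) hΔlo
  have hsT := hsT_of_floors (v := v) (vβ := vβ) hn hΔlo hΔhi P2
  have hNA := NA_le (v := v) (vβ := vβ) (T := T) (bL := bL) hn hΔlo hΔhi P2 P4
  obtain ⟨l0b, hNB⟩ := NB_le (vβ := vβ) hn hvn hΔlo hΔhi P1 P2 P3 P4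
  have uqy := Uqy_le (vβ := vβ) hn hvn hΔlo hΔhi P1 P2 P3 P4
  have hU : (0 : ℤ) ≤ (shearUnit n h : ℤ) := by positivity
  have hn1 : (1 : ℤ) ≤ n := by exact_mod_cast hn
  have hU1 : (1 : ℤ) ≤ (shearUnit n h : ℤ) := by have := n_le_U n h; linarith
  have hΔ : (0 : ℤ) < modulus n h v vβ := by linarith
  have hn0 : (0 : ℤ) ≤ n := by positivity
  have hT0 : (0 : ℤ) ≤ T := by positivity
  have hv0 : (0 : ℤ) ≤ |v| := abs_nonneg v
  have hTn' : 2000 * T ≤ n := by omega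
  have hTn : 2000 * (T : ℤ) ≤ n := by exact_mod_cast hTn'
  have hUU : (shearUnit n h : ℤ) = ((n + h.natAbs : ℕ) : ℤ) := rfl
  set U : ℤ := (shearUnit n h : ℤ) with hUdef
  set Δ : ℤ := modulus n h v vβ with hΔdef
  set Q : ℤ := ((Qw n ℓ h : ℕ) : ℤ)
  set La : ℤ := ((3 * (n * ℓ) / shearUnit n h + 1 : ℕ) : ℤ)
  set qY : ℤ := ((qy n ℓ h v T aW bL : ℕ) : ℤ)
  set LA : ℤ := ((L0A bL : ℕ) : ℤ)
  set LB : ℤ := ((L0B n ℓ h v T aW bL : ℕ) : ℤ)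
  have hTU0 : (0 : ℤ) ≤ (T : ℤ) * U := by positivity
  have hA1 : U * (LA + Q + T + La + 1) ≤ 17 * Δ := by linarith
  have hB1 : U * (qY + La + 1) ≤ 5 * Δ := by linarith
  have hl := mul_le_mul_of_nonneg_left l0b hΔ.le
  have hΔT := mul_le_mul_of_nonneg_left hTn hΔ.le
  have hΔn : (0 : ℤ) ≤ Δ * n := by positivity
  have hX0 : Δ * (LB + T + n) ≤ 51 * Δ * n := by linarith
  have hA1v : |v| * (U * (LA + Q + T + La + 1)) ≤ n * (17 * Δ) := mul_le_mul hvn hA1 (by positivity) hn0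
  have hB1v : |v| * (U * (qY + La + 1)) ≤ n * (5 * Δ) := mul_le_mul hvn hB1 (by positivity) hn0
  refine ⟨by linarith, by linarith, by linarith, by linarith, hsT, by omega, by omega, ?_, by omega⟩
  rw [← hUU]
  have : (0 : ℤ) ≤ ((T : ℤ) + 2) * U := by positivity
  linarith

/-! ## §3 The floors of the band -/

include hn hvn hΔlo hΔhi P1 P2 in
/-- **The band floors `hbx1–3`, `hby1–3`** from (P1)–(P4). [cite: KozmaNitzan2024, §4 Lemma 11 (p. 22), Lemma 12 (pp. 23–25)] -/
theorem floors_band {P : PCells2} (P3 : ((WA n aW : ℕ) : ℤ) ≤ 24 * n) (P4 : (shearUnit n h : ℤ) * (((L0A bL : ℕ) : ℤ) + 1) ≤ 12 * modulus n h v vβ) :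
    (modulus n h v vβ * (2 * n + 800 * T) + |v| * ((shearUnit n h : ℤ) * ((qy n ℓ h v T aW bL : ℕ) + 800 * T + (3 * (n * ℓ) / shearUnit n h + 1 : ℕ) + 1))
      + 3 * modulus n h v vβ * n ≤ 40 * 5 * modulus n h v vβ * n) ∧
    (modulus n h v vβ * (801 * n + 800 * T) + |v| * ((shearUnit n h : ℤ) * ((qy n ℓ h v T aW bL : ℕ) + 800 * T + (3 * (n * ℓ) / shearUnit n h + 1 : ℕ) + 1))
      + 3 * modulus n h v vβ * n ≤ 40 * 22 * modulus n h v vβ * n) ∧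
    ((shearUnit n h : ℤ) * ((qy n ℓ h v T aW bL : ℕ) + 800 * T + (3 * (n * ℓ) / shearUnit n h + 1 : ℕ) + 1) + 2 * modulus n h v vβ ≤
      40 * 2 * modulus n h v vβ) ∧
    ((shearUnit n h : ℤ) * (((qy n ℓ h v T aW bL : ℕ) : ℤ) + 800 * T + (3 * (n * ℓ) / shearUnit n h + 1 : ℕ) + 1) + 2 * modulus n h v vβ ≤
      40 * 5 * modulus n h v vβ) ∧
    ((shearUnit n h : ℤ) * (799 * ((Qw n ℓ h : ℕ) : ℤ) + (qy n ℓ h v T aW bL : ℕ) + 800 * T + (3 * (n * ℓ) / shearUnit n h + 1 : ℕ) + 1) +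
      2 * modulus n h v vβ ≤ 40 * 22 * modulus n h v vβ) ∧
    ((P.r 0 : ℤ) * (modulus n h v vβ * (((Wmy n v : ℕ) : ℤ) + (Wpy n v : ℕ) + 800 * T + n) +
        |v| * ((shearUnit n h : ℤ) * ((2397 + ((qy n ℓ h v T aW bL : ℕ) : ℤ) + 800 * T + (3 * (n * ℓ) / shearUnit n h + 1 : ℕ)) + 1)) +
        |v| * (800 * (n + (shearUnit n h : ℤ)))) + 40 * modulus n h v vβ * n + (P.r 0 : ℤ) * n ≤ 40 * modulus n h v vβ * (n * (2 * (P.r 0 : ℤ)))) := by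
  obtain ⟨f1, f2, f3⟩ := U_floor (v := v) (vβ := vβ) hΔlo P2
  obtain ⟨uq, lq⟩ := UQ_le (v := v) (vβ := vβ) (ℓ := ℓ) hn hΔlo hΔhi
  have ula := ULa_le (v := v) (vβ := vβ) (ℓ := ℓ) (n := n) (h := h) hΔlo
  have uqy := Uqy_le (vβ := vβ) hn hvn hΔlo hΔhi P1 P2 P3 P4
  have hU : (0 : ℤ) ≤ (shearUnit n h : ℤ) := by positivity
  have hnU := n_le_U n h
  have hn1 : (1 : ℤ) ≤ n := by exact_mod_cast hn
  have hΔ : (0 : ℤ) < modulus n h v vβ := by linarith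
  have hn0 : (0 : ℤ) ≤ n := by positivity
  have hT0 : (0 : ℤ) ≤ T := by positivity
  have hv0 : (0 : ℤ) ≤ |v| := abs_nonneg v
  have hTn' : 2000 * T ≤ n := by omega
  have hTn : 2000 * (T : ℤ) ≤ n := by exact_mod_cast hTn'
  have hr0 : (20 : ℤ) ≤ P.r 0 := by have := P.twenty_mul_s_le_r 0; have := P.hs 0; omega
  have hW := Wmy_add_Wpy n v
  set U : ℤ := (shearUnit n h : ℤ) with hUdef
  set Δ : ℤ := modulus n h v vβ with hΔdef
  set Q : ℤ := ((Qw n ℓ h : ℕ) : ℤ)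
  set La : ℤ := ((3 * (n * ℓ) / shearUnit n h + 1 : ℕ) : ℤ)
  set qY : ℤ := ((qy n ℓ h v T aW bL : ℕ) : ℤ)
  set R : ℤ := (P.r 0 : ℤ)
  have hTU0 : (0 : ℤ) ≤ (T : ℤ) * U := by positivity
  have hUX : U * (qY + 800 * T + La + 1) ≤ 5 * Δ := by linarith
  have hvX : |v| * (U * (qY + 800 * T + La + 1)) ≤ n * (5 * Δ) := mul_le_mul hvn hUX (by positivity) hn0
  have hΔT := mul_le_mul_of_nonneg_left hTn hΔ.le
  have hΔn : (0 : ℤ) ≤ Δ * n := by positivity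
  have h799 := mul_le_mul_of_nonneg_left uq (by norm_num : (0 : ℤ) ≤ 799)
  refine ⟨by linarith, by linarith, by linarith, by linarith, by linarith, ?_⟩
  have hUY : U * ((2397 + qY + 800 * T + La) + 1) ≤ 6 * Δ := by linarith
  have hvY : |v| * (U * ((2397 + qY + 800 * T + La) + 1)) ≤ n * (6 * Δ) := mul_le_mul hvn hUY (by positivity) hn0
  have h8 : 800 * (n + U) ≤ Δ := by linarith
  have hv8 : |v| * (800 * (n + U)) ≤ n * Δ := mul_le_mul hvn h8 (by positivity) hn0
  have hin : Δ * (2 * n + |v| + 800 * T + n) + |v| * (U * ((2397 + qY + 800 * T + La) + 1)) + |v| * (800 * (n + U)) ≤ 12 * (Δ * n) := by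
    have : Δ * |v| ≤ Δ * n := mul_le_mul_of_nonneg_left hvn hΔ.le
    linarith
  rw [hW]
  have hR0 : (0 : ℤ) ≤ R := by linarith
  have k1 := mul_le_mul_of_nonneg_left hin hR0
  have k2 : 40 * (Δ * n) ≤ 2 * (Δ * n) * R := by have := mul_le_mul_of_nonneg_left hr0 (by positivity : (0 : ℤ) ≤ 2 * (Δ * n)); linarith
  have k3 : R * n ≤ (Δ * n) * R := by have := mul_le_mul_of_nonneg_left (show (1 : ℤ) ≤ Δ by linarith) (by positivity : (0 : ℤ) ≤ R * n); linarith
  have k4 : (0 : ℤ) ≤ Δ * n * R := by positivity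
  linarith

/-! ## §4 The floors of the targets -/

include hn hvn hΔlo hΔhi P1 P2 in
/-- **The target floors `hxL1`, `hxL3`, `hyL1–3`** from (P1)–(P5) — (P5) `r_i ≤ 4·b₀_i` is RULING B.16 (`b₀ := r/4`).
[cite: KozmaNitzan2024, §4 Lemma 12 (pp. 23–25), p. 26 (M_v)] -/
theorem floors_target {P : PCells2} {b₀ : Fin 2 → ℕ} (P3 : ((WA n aW : ℕ) : ℤ) ≤ 24 * n)
    (P4 : (shearUnit n h : ℤ) * (((L0A bL : ℕ) : ℤ) + 1) ≤ 12 * modulus n h v vβ) (P5 : ∀ i, P.r i ≤ 4 * b₀ i) :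
    (40 * modulus n h v vβ * n * (20 * (P.r 0 : ℤ) - (b₀ 0 : ℕ) + 1) + (P.r 0 : ℤ) * n +
      (P.r 0 : ℤ) * (|v| * ((shearUnit n h : ℤ) * ((qy n ℓ h v T aW bL : ℕ) + 800 * T + 1))) ≤ (P.r 0 : ℤ) * (modulus n h v vβ * (799 * n - 800 * T))) ∧
    ((P.r 1 : ℤ) * ((shearUnit n h : ℤ) * ((qy n ℓ h v T aW bL : ℕ) + 800 * T + 1)) + 40 * modulus n h v vβ ≤ 40 * modulus n h v vβ * (b₀ 1 : ℕ)) ∧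
    (40 * modulus n h v vβ * (20 * (P.r 1 : ℤ) - (b₀ 1 : ℕ) + 1) + (P.r 1 : ℤ) * ((shearUnit n h : ℤ) - 1) <
      (P.r 1 : ℤ) * ((shearUnit n h : ℤ) * (800 * sA n ℓ h - (qy n ℓ h v T aW bL : ℕ) - 800 * T))) ∧
    ((P.r 1 : ℤ) * ((shearUnit n h : ℤ) * (800 * ((Qw n ℓ h : ℕ) : ℤ) + (qy n ℓ h v T aW bL : ℕ) + 800 * T) + shearUnit n h - 1) <
      40 * modulus n h v vβ * (20 * (P.r 1 : ℤ) + (b₀ 1 : ℕ) - 1)) ∧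
    ((P.r 0 : ℤ) * (modulus n h v vβ * (((Wmy n v : ℕ) : ℤ) + (Wpy n v : ℕ) + 800 * T) +
        |v| * ((shearUnit n h : ℤ) * ((2400 + ((qy n ℓ h v T aW bL : ℕ) : ℤ) + 800 * T) + 1)) + |v| * (800 * (n + (shearUnit n h : ℤ)))) +
        40 * modulus n h v vβ * n + (P.r 0 : ℤ) * n ≤ 40 * modulus n h v vβ * (n * ((b₀ 0 : ℕ) : ℤ))) := by
  obtain ⟨f1, f2, f3⟩ := U_floor (v := v) (vβ := vβ) hΔlo P2
  obtain ⟨uq, lq⟩ := UQ_le (v := v) (vβ := vβ) (ℓ := ℓ) hn hΔlo hΔhi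
  have usa := UsA_ge (v := v) (vβ := vβ) (ℓ := ℓ) hn hΔhi
  have uqy := Uqy_le (vβ := vβ) hn hvn hΔlo hΔhi P1 P2 P3 P4
  have hU : (0 : ℤ) ≤ (shearUnit n h : ℤ) := by positivity
  have hnU := n_le_U n h
  have hn1 : (1 : ℤ) ≤ n := by exact_mod_cast hn
  have hΔ : (0 : ℤ) < modulus n h v vβ := by linarith
  have hn0 : (0 : ℤ) ≤ n := by positivity
  have hT0 : (0 : ℤ) ≤ T := by positivity
  have hv0 : (0 : ℤ) ≤ |v| := abs_nonneg v
  have hTn' : 2000 * T ≤ n := by omega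
  have hTn : 2000 * (T : ℤ) ≤ n := by exact_mod_cast hTn'
  have hr0 : (20 : ℤ) ≤ P.r 0 := by have := P.twenty_mul_s_le_r 0; have := P.hs 0; omega
  have hr1 : (20 : ℤ) ≤ P.r 1 := by have := P.twenty_mul_s_le_r 1; have := P.hs 1; omega
  have hb0 : (P.r 0 : ℤ) ≤ 4 * ((b₀ 0 : ℕ) : ℤ) := by exact_mod_cast P5 0
  have hb1 : (P.r 1 : ℤ) ≤ 4 * ((b₀ 1 : ℕ) : ℤ) := by exact_mod_cast P5 1
  have hW := Wmy_add_Wpy n v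
  set U : ℤ := (shearUnit n h : ℤ) with hUdef
  set Δ : ℤ := modulus n h v vβ with hΔdef
  set Q : ℤ := ((Qw n ℓ h : ℕ) : ℤ)
  set qY : ℤ := ((qy n ℓ h v T aW bL : ℕ) : ℤ)
  set R : ℤ := (P.r 0 : ℤ) with hR
  set S : ℤ := (P.r 1 : ℤ) with hS
  set B0 : ℤ := ((b₀ 0 : ℕ) : ℤ)
  set B1 : ℤ := ((b₀ 1 : ℕ) : ℤ)
  have hTU0 : (0 : ℤ) ≤ (T : ℤ) * U := by positivity
  have hR0 : (0 : ℤ) ≤ R := by linarith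
  have hS0 : (0 : ℤ) ≤ S := by linarith
  have hΔn : (0 : ℤ) ≤ Δ * n := by positivity
  have hC1 : 2 * (U * (qY + 800 * T + 1)) ≤ 3 * Δ := by linarith
  have hC : 2 * (|v| * (U * (qY + 800 * T + 1))) ≤ 3 * (Δ * n) := by
    have h1 := mul_le_mul hvn (le_refl (U * (qY + 800 * T + 1))) (by positivity) hn0
    have h2 := mul_le_mul_of_nonneg_left hC1 hn0
    linarith
  have hΔ4 : (4000 : ℤ) ≤ Δ := by linarith
  have hS1 : (1 : ℤ) ≤ S := by linarith
  refine ⟨?_, ?_, ?_, ?_, ?_⟩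
  · -- hxL1
    have k1 := mul_le_mul_of_nonneg_left hC hR0
    have k2 : 10 * (Δ * n) * R ≤ 40 * (Δ * n) * B0 := by have := mul_le_mul_of_nonneg_left hb0 (by positivity : (0 : ℤ) ≤ 10 * (Δ * n)); linarith
    have k3 : 40 * (Δ * n) ≤ 2 * (Δ * n) * R := by have := mul_le_mul_of_nonneg_left hr0 (by positivity : (0 : ℤ) ≤ 2 * (Δ * n)); linarith
    have k4 : 4000 * (R * n) ≤ (Δ * n) * R := by have := mul_le_mul_of_nonneg_left hΔ4 (by positivity : (0 : ℤ) ≤ R * n); linarith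
    have k5 : 2000 * (R * (Δ * T)) ≤ R * (Δ * n) := by have := mul_le_mul_of_nonneg_left (mul_le_mul_of_nonneg_left hTn hΔ.le) hR0; linarith
    have k6 : (0 : ℤ) ≤ Δ * n * R := by positivity
    linarith [k1, k2, k3, k4, k5, k6]
  · -- hxL3
    have k1 : 2 * (S * (U * (qY + 800 * T + 1))) ≤ 3 * Δ * S := by have := mul_le_mul_of_nonneg_left hC1 hS0; linarith
    have k2 : 10 * Δ * S ≤ 40 * Δ * B1 := by have := mul_le_mul_of_nonneg_left hb1 (by positivity : (0 : ℤ) ≤ 10 * Δ); linarith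
    have k3 : 40 * Δ ≤ 2 * Δ * S := by have := mul_le_mul_of_nonneg_left hr1 (by positivity : (0 : ℤ) ≤ 2 * Δ); linarith
    linarith [k1, k2, k3]
  · -- hyL1
    have k1 : S * (Δ - 3 * U) ≤ S * (U * sA n ℓ h) := mul_le_mul_of_nonneg_left usa hS0
    have k2 : S * (U * qY) ≤ S * (Δ + 2 * U + 101 * T * U) := mul_le_mul_of_nonneg_left uqy hS0
    have k3 : 2000 * (S * ((T : ℤ) * U)) ≤ S * Δ := by have := mul_le_mul_of_nonneg_left f3 hS0; linarith
    have k4 : 4000 * (S * U) ≤ S * Δ := by have := mul_le_mul_of_nonneg_left f2 hS0; linarith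
    have k5 : 10 * Δ * S ≤ 40 * Δ * B1 := by have := mul_le_mul_of_nonneg_left hb1 (by positivity : (0 : ℤ) ≤ 10 * Δ); linarith
    have k6 : 40 * Δ ≤ 2 * Δ * S := by have := mul_le_mul_of_nonneg_left hr1 (by positivity : (0 : ℤ) ≤ 2 * Δ); linarith
    have k7 : (0 : ℤ) < Δ * S := by positivity
    linarith [k1, k2, k3, k4, k5, k6, k7]
  · -- hyL2
    have k1 : S * (U * Q) ≤ S * (Δ + 2 * U) := mul_le_mul_of_nonneg_left uq hS0
    have k2 : S * (U * qY) ≤ S * (Δ + 2 * U + 101 * T * U) := mul_le_mul_of_nonneg_left uqy hS0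
    have k3 : 2000 * (S * ((T : ℤ) * U)) ≤ S * Δ := by have := mul_le_mul_of_nonneg_left f3 hS0; linarith
    have k4 : 4000 * (S * U) ≤ S * Δ := by have := mul_le_mul_of_nonneg_left f2 hS0; linarith
    have k5 : 10 * Δ * S ≤ 40 * Δ * B1 := by have := mul_le_mul_of_nonneg_left hb1 (by positivity : (0 : ℤ) ≤ 10 * Δ); linarith
    have k6 : 40 * Δ ≤ 2 * Δ * S := by have := mul_le_mul_of_nonneg_left hr1 (by positivity : (0 : ℤ) ≤ 2 * Δ); linarith
    have k7 : (0 : ℤ) < Δ * S := by positivity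
    linarith [k1, k2, k3, k4, k5, k6, k7]
  · -- hyL3
    rw [hW]
    have hUY : U * ((2400 + qY + 800 * T) + 1) ≤ 3 * Δ := by linarith
    have hvY : |v| * (U * ((2400 + qY + 800 * T) + 1)) ≤ n * (3 * Δ) := mul_le_mul hvn hUY (by positivity) hn0
    have h8 : 5 * (800 * (n + U)) ≤ 2 * Δ := by linarith
    have hv8 : 5 * (|v| * (800 * (n + U))) ≤ 2 * (n * Δ) := by
      have h1 := mul_le_mul hvn (le_refl (800 * (n + U))) (by positivity) hn0
      have h2 := mul_le_mul_of_nonneg_left h8 hn0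
      linarith
    have hΔT := mul_le_mul_of_nonneg_left hTn hΔ.le
    have hΔv : Δ * |v| ≤ Δ * n := mul_le_mul_of_nonneg_left hvn hΔ.le
    have hin : 5 * (Δ * (2 * n + |v| + 800 * T) + |v| * (U * ((2400 + qY + 800 * T) + 1)) + |v| * (800 * (n + U))) ≤ 36 * (Δ * n) := by
      linarith
    have k1 := mul_le_mul_of_nonneg_left hin hR0
    have k2 : 10 * (Δ * n) * R ≤ 40 * (Δ * n) * B0 := by have := mul_le_mul_of_nonneg_left hb0 (by positivity : (0 : ℤ) ≤ 10 * (Δ * n)); linarith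
    have k3 : 40 * (Δ * n) ≤ 2 * (Δ * n) * R := by have := mul_le_mul_of_nonneg_left hr0 (by positivity : (0 : ℤ) ≤ 2 * (Δ * n)); linarith
    have k4 : 4000 * (R * n) ≤ (Δ * n) * R := by have := mul_le_mul_of_nonneg_left hΔ4 (by positivity : (0 : ℤ) ≤ R * n); linarith
    have k6 : (0 : ℤ) ≤ Δ * n * R := by positivity
    linarith [k1, k2, k3, k4, k6]

end Units

end CorrRec

end Skelφ

end Transplant

end Summit.CriticalPhenomena.PercolationContinuityZ3.Theorems

end
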